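import Summits.QuantumFields.YangMills.Theorems.PencilRigidityDiagonalMirrorRPRStubRpClosure
import Summits.QuantumFields.YangMills.Theorems.PencilRigidityDiagonalMirrorRPRCentreTwistDefs

/-!
# Crux `DiagonalMirrorRPR` (stmt-QuantumFields-10604), line `kms-variance-lukewarm-descent` (lead a2 tree), stub
# `stub_rpClosureTwisted` (S4''): the lattice half — centre invariance of the curvature field, twisted Gram positivity

First of the two modules proving the registered stub `stub_rpClosureTwisted` (S4'', namespace `…CentreTwistedSwap`)
of the skeleton `Cruxes/DiagonalMirrorRPR/Lines/kms_variance_lukewarm_descent.lean`: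
`…StubRpClosureTwistedLattice` (this module, the lattice half, registered sub-goal
`stub_rpClosureTwisted_latticePSD`) ← `…StubRpClosureTwisted` (the OS-limit closure and the stub).

§A'' For a CENTRAL `z`, multiplying every `e₁`-link of a `ℤ⁴`-configuration on the left by `z` changes no
plaquette holonomy (the `e₁`-links of a plaquette enter as one forward and one inverse factor; the group computation
of `tplaq_centreTwist`, `…CentreTwistDefs`), hence not Wilson's action density `actionDensity`; the skew lift and the
translations intertwine the centre twist `centreTwist z` of the 45° cover `T̃_N` with this operation, so the smeared
curvature field of the cover is centre blind: `coverField r sch k h (centreTwist z U) = coverField r sch k h U`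
(`coverField_centreTwist`).  §H₁'' The twin `lattice_psd_twisted` of `RpClosure.lattice_psd`
(`…StubRpClosureLattice` §H₁): `Θ'_z`-reflection positivity of Wilson's measure on the cover
(`CoverTwistedSwapRPAt r.ρ z β N`, `Θ'_z = C_z ∘ θ^*`) applied to `F = ∑_J c_J A_J` for bounded measurable real
observables `A_J` of the closed positive half that are blind to `C_z` gives the PLAIN Gram positivity
`∑_{I,J} c̄_I c_J ⟨(A_I ∘ θ^*) · A_J⟩ ≥ 0`, since `F ∘ Θ'_z = F ∘ θ^*`.

References: Fröhlich–Israel–Lieb–Simon, Comm. Math. Phys. 62 (1978) Thm 2.1; 't Hooft, Nucl. Phys. B153 (1979) 141;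
Osterwalder–Seiler, Ann. Phys. 110 (1978) §2; Wilson, Phys. Rev. D 10 (1974).
-/

set_option autoImplicit false

noncomputable section

open scoped SchwartzMap ComplexConjugate
open MeasureTheory Filter Topology
open Literature.MathematicalPhysics.QuantumLattice Literature.MathematicalPhysics.AQFT
  Literature.MathematicalPhysics.QuantumFieldTheory

namespace Summit.QuantumFields.YangMills.Cruxes.DiagonalMirrorRPR.CentreTwistedSwap

open ParityBridgeColdTraces ParityBridgeColdTraces.RpClosure

/-! # Proof material (sub-namespace `RpClosureTwisted`) -/

namespace RpClosureTwisted

/-! ## §A'' A central twist of the `e₁`-links of `ℤ⁴`: plaquettes, the action density and the curvature field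
are blind to it -/

section Lattice

open Literature.Probability.LatticeModels (Site)

variable {G : Type} [Group G] {z : G}

-- the two group computations are adapted from the private `twist_plaq_left/right` of `…CentreTwistDefs`
/-- `i = 1 ≠ j`: the two `e₁`-links of the plaquette are its first (forward) and third (inverse) factors. -/
private theorem twist_plaq_left (hz : ∀ g : G, g * z = z * g) (a b c d : G) :
    z * a * b * (z * c)⁻¹ * d⁻¹ = a * b * c⁻¹ * d⁻¹ := by
  have h1 : z * a * b * (z * c)⁻¹ = a * b * c⁻¹ := by
    rw [mul_inv_rev, ← hz a, mul_assoc a z b, ← hz b, ← mul_assoc a b z, mul_assoc (a * b) z (c⁻¹ * z⁻¹),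
      ← mul_assoc z c⁻¹ z⁻¹, ← hz c⁻¹, mul_inv_cancel_right]
  rw [h1]

/-- `i ≠ 1 = j`: the two `e₁`-links of the plaquette are its second (forward) and fourth (inverse) factors. -/
private theorem twist_plaq_right (hz : ∀ g : G, g * z = z * g) (a b c d : G) :
    a * (z * b) * c⁻¹ * (z * d)⁻¹ = a * b * c⁻¹ * d⁻¹ := by
  rw [mul_inv_rev, ← hz b, ← mul_assoc a b z, mul_assoc (a * b) z c⁻¹, ← hz c⁻¹, ← mul_assoc (a * b) c⁻¹ z,
    mul_assoc (a * b * c⁻¹) z (d⁻¹ * z⁻¹), ← mul_assoc z d⁻¹ z⁻¹, ← hz d⁻¹, mul_inv_cancel_right]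

/-- **Plaquette holonomies of `ℤ⁴` are blind to a central twist of the `e₁`-links.** If `V'` is `V` with every
`e₁`-link multiplied on the left by a central `z`, every plaquette holonomy of `V'` equals that of `V` (every site,
every direction pair — the `e₁`-links of a plaquette come as one forward and one inverse factor). -/
theorem plaquetteHolonomyZd_eq_of_centreTwist (hz : z ∈ Subgroup.center G) {V V' : LGConfig 4 G}
    (h1 : ∀ y, V' (y, 1) = z * V (y, 1)) (hne : ∀ y (k : Fin 4), k ≠ 1 → V' (y, k) = V (y, k))
    (x : Site 4) (i j : Fin 4) : plaquetteHolonomyZd V' x i j = plaquetteHolonomyZd V x i j := by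
  -- adapted from `tplaq_centreTwist` (…CentreTwistDefs)
  have hc : ∀ g : G, g * z = z * g := fun g => Subgroup.mem_center_iff.1 hz g
  unfold plaquetteHolonomyZd
  by_cases hi : i = 1 <;> by_cases hj : j = 1
  · subst hi; subst hj
    simp only [h1, mul_inv_cancel_right, mul_inv_cancel]
  · subst hi
    simp only [h1, hne _ _ hj]
    exact twist_plaq_left hc _ _ _ _
  · subst hj
    simp only [h1, hne _ _ hi]
    exact twist_plaq_right hc _ _ _ _
  · simp only [hne _ _ hi, hne _ _ hj]

/-- **Wilson's action density at the origin is blind to a central twist of the `e₁`-links** (it is a function of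
plaquette holonomies). -/
theorem actionDensity_eq_of_centreTwist {Nc : ℕ} (ρ : G →* Matrix (Fin Nc) (Fin Nc) ℂ)
    (hz : z ∈ Subgroup.center G) {V V' : LGConfig 4 G} (h1 : ∀ y, V' (y, 1) = z * V (y, 1))
    (hne : ∀ y (k : Fin 4), k ≠ 1 → V' (y, k) = V (y, k)) : actionDensity ρ V' = actionDensity ρ V := by
  simp only [actionDensity, plaquetteObs, plaquetteHolonomyZd_eq_of_centreTwist hz h1 hne]

/-- **The smeared curvature field of the cover is invariant under the centre twist**:
`Φ̃_k(h)(C_z U) = Φ̃_k(h)(U)` for central `z` — the curvature observable is Wilson's action density, and the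
translated skew lift of `C_z U` is the translated skew lift of `U` with every `e₁`-link multiplied by `z`. -/
theorem coverField_centreTwist [TopologicalSpace G] [IsTopologicalGroup G] [CompactSpace G] [MeasurableSpace G]
    [BorelSpace G] (r : LatticeRep G) (sch : SpeciesScheme (YMSpecies G)) (k : ℕ) (h : 𝓢(E4, ℝ))
    (hz : z ∈ Subgroup.center G) (U : TConfig (2 * sch.side k) (sch.side k) (sch.side k) G) :
    coverField r sch k h (centreTwist z U) = coverField r sch k h U := by
  unfold coverField smearedLatticeField
  congr 1
  refine Finset.sum_congr rfl fun x _ => ?_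
  congr 2
  refine actionDensity_eq_of_centreTwist r.ρ hz (fun y => ?_) (fun y k hk => ?_)
  · simp only [configShift_apply, skewLift, centreTwist_apply_one]
  · simp only [configShift_apply, skewLift, centreTwist_apply_of_ne z U hk]

end Lattice

/-! ## §H₁'' Twisted RP of the cover on finite centre-blind families -/

section LatticePSD

variable {G : Type} [Group G] [TopologicalSpace G] [IsTopologicalGroup G] [CompactSpace G]
  [MeasurableSpace G] [BorelSpace G]

/-- **Twisted RP of the cover on finite families of centre-blind observables (the lattice Gram matrix is
Hermitian positive).** For bounded measurable real observables `A_I` of the closed positive half that are blind to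
the centre twist `C_z` and coefficients `c_I`, `∑_{I,J} c̄_I c_J ⟨(A_I ∘ θ^*) · A_J⟩ = ⟨conj(F ∘ Θ'_z) · F⟩ ≥ 0`
with `F = ∑_J c_J A_J`, since `F ∘ Θ'_z = F ∘ C_z ∘ θ^* = F ∘ θ^*`. -/
theorem lattice_psd_twisted (r : LatticeRep G) (β : ℝ) (N : ℕ) [NeZero N] {z : G}
    (hRP : CoverTwistedSwapRPAt r.ρ z β N) {ι : Type} [Fintype ι] (A : ι → TConfig (2 * N) N N G → ℝ)
    (hAm : ∀ I, Measurable (A I)) (hAb : ∀ I, ∃ C : ℝ, ∀ U, |A I U| ≤ C)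
    (hAd : ∀ I, DependsOn (A I) (posEdges N)) (hAz : ∀ I U, A I (centreTwist z U) = A I U) (coef : ι → ℂ) :
    let w := ∑ I, ∑ J, conj (coef I) * coef J *
      texp r.ρ β true (fun U => ((A I (swapConfig U) * A J U : ℝ) : ℂ))
    0 ≤ w.re ∧ w.im = 0 := by
  -- adapted from `RpClosure.lattice_psd` (…StubRpClosureLattice §H₁): only the last step changes
  intro w
  haveI : SecondCountableTopology G := secondCountable_of_rep r
  let Fc : TConfig (2 * N) N N G → ℂ := fun U => ∑ J, coef J * ((A J U : ℝ) : ℂ)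
  have hFm : Measurable Fc :=
    Finset.measurable_sum _ fun J _ => (Complex.measurable_ofReal.comp (hAm J)).const_mul _
  choose C hC using hAb
  have hFb : ∃ C₀ : ℝ, ∀ U, ‖Fc U‖ ≤ C₀ := by
    refine ⟨∑ J, ‖coef J‖ * C J, fun U => (norm_sum_le _ _).trans (Finset.sum_le_sum fun J _ => ?_)⟩
    rw [norm_mul, Complex.norm_real, Real.norm_eq_abs]
    exact mul_le_mul_of_nonneg_left (hC J U) (norm_nonneg _)
  have hFd : DependsOn Fc (posEdges N) := fun U V hUV =>
    Finset.sum_congr rfl fun J _ => by rw [hAd J hUV]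
  have hint : ∀ I J, Integrable (fun U => ((A I (swapConfig U) * A J U : ℝ) : ℂ) * ((tweight r.ρ β true U : ℝ) : ℂ))
      (thaar (2 * N) N N) := fun I J => by
    refine integrable_mul_tweight r.ρ β true r.continuous
      (Complex.measurable_ofReal.comp (((hAm I).comp measurable_swapConfig).mul (hAm J)))
      ⟨C I * C J, fun U => ?_⟩
    rw [Complex.norm_real, Real.norm_eq_abs, abs_mul]
    exact mul_le_mul (hC I _) (hC J _) (abs_nonneg _) ((abs_nonneg _).trans (hC I (swapConfig U)))
  have hw : w = texp r.ρ β true fun U => conj (Fc (swapConfig U)) * Fc U := by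
    have hfun : (fun U => conj (Fc (swapConfig U)) * Fc U) = fun U => ∑ I, conj (coef I) *
        ∑ J, coef J * ((A I (swapConfig U) * A J U : ℝ) : ℂ) := by
      funext U
      simp only [Fc, map_sum, map_mul, Complex.conj_ofReal]
      rw [Finset.sum_mul_sum]
      refine Finset.sum_congr rfl fun I _ => ?_
      rw [Finset.mul_sum]
      refine Finset.sum_congr rfl fun J _ => ?_
      push_cast
      ring
    rw [hfun, texp_sum_mul r.ρ β true _ _ _ fun I _ => ?_]
    · simp only [w]
      refine Finset.sum_congr rfl fun I _ => ?_
      rw [texp_sum_mul r.ρ β true _ _ _ fun J _ => hint I J, Finset.mul_sum]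
      refine Finset.sum_congr rfl fun J _ => ?_
      ring
    · simp only [Finset.sum_mul]
      refine integrable_finsetSum _ fun J _ => ?_
      simp only [mul_assoc]
      exact (hint I J).const_mul _
  -- NEW: `Fc ∘ Θ'_z = Fc ∘ θ^*`, so twisted RP of `Fc` is the plain Gram positivity
  have hFz : ∀ U, Fc (twistSwapConfig z U) = Fc (swapConfig U) := fun U => by
    simp only [Fc, twistSwapConfig_eq, hAz]
  have key := hRP Fc hFm hFb hFd
  simp only [hFz] at key
  rw [hw]
  exact key

end LatticePSD

end RpClosureTwisted

/-- **Registered sub-goal `stub_rpClosureTwisted_latticePSD` of `stub_rpClosureTwisted` (the lattice Gram matrix of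
centre-blind observables is Hermitian positive under TWISTED cover RP).**  `Θ'_z`-RP of Wilson's measure on the 45°
cover (`CoverTwistedSwapRPAt r.ρ z β N`) applied to `F = ∑_J c_J A_J`, the `A_J` bounded measurable real observables
of the closed positive half with `A_J ∘ C_z = A_J`: `∑_{I,J} c̄_I c_J ⟨(A_I ∘ θ^*) · A_J⟩ = ⟨conj(F ∘ Θ'_z) · F⟩`
is a non-negative real. -/
theorem stub_rpClosureTwisted_latticePSD :
    ∀ {G : Type} [Group G] [TopologicalSpace G] [IsTopologicalGroup G] [CompactSpace G] [MeasurableSpace G]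
      [BorelSpace G] (r : LatticeRep G) (β : ℝ) (N : ℕ) [NeZero N] (z : G), CoverTwistedSwapRPAt r.ρ z β N →
      ∀ {ι : Type} [Fintype ι] (A : ι → TConfig (2 * N) N N G → ℝ), (∀ I, Measurable (A I)) →
        (∀ I, ∃ C : ℝ, ∀ U, |A I U| ≤ C) → (∀ I, DependsOn (A I) (posEdges N)) →
          (∀ I U, A I (centreTwist z U) = A I U) → ∀ (coef : ι → ℂ),
            0 ≤ (∑ I, ∑ J, conj (coef I) * coef J *
                texp r.ρ β true (fun U => ((A I (swapConfig U) * A J U : ℝ) : ℂ))).re ∧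
              (∑ I, ∑ J, conj (coef I) * coef J *
                texp r.ρ β true (fun U => ((A I (swapConfig U) * A J U : ℝ) : ℂ))).im = 0 :=
  fun r β N _ _ hRP _ _ A hAm hAb hAd hAz coef => RpClosureTwisted.lattice_psd_twisted r β N hRP A hAm hAb hAd hAz coef

end Summit.QuantumFields.YangMills.Cruxes.DiagonalMirrorRPR.CentreTwistedSwap

end
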